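import Literature.Probability.LatticeModels.BalabanStepOneFormatXYAction
import Literature.Probability.LatticeModels.BalabanStepOneFormatPolymerGas

/-!
# Balaban's step-one format — calibration, part 2c: the XY cluster activities are polymer activities

The large-field half of the membership of the XY Gibbs weight in Balaban's step-one format: the
CLUSTER ACTIVITIES

  `xyActivity K P θ = [IsConn P ∧ P = collar (P ∩ LF θ) ∧ P ∩ LF θ ≠ ∅] · Π_{b touching P ∩ LF θ} e^{-K(1 - cos ∂_b θ)}`

(`LF θ = lfSet K θ`; the activity of a polymer is the product of the Gibbs factors of the bonds
touching its large-field sites, provided the polymer is connected and is exactly the collar of its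
large-field sites) satisfy every clause of `PolymerActivity K cL κ` (`xyActivity_polymerActivity`):
locality on the collar (large-field membership of a site is read off its incident bonds), translation
covariance, support on connected polymers, measurability (the large-field set takes finitely many
values on measurable fibres), and the LARGE-FIELD BOUND
`|g P θ| ≤ exp (-cL log² K · |P ∩ LF| - κ |P \ LF|)` under the threshold condition
`XYThreshold K cL κ : cL log² K + 6κ ≤ K (1 - cos η(K)) / 2` — by the counting estimate
`sum_touch_ge` (every large-field site owns an incident bond with `1 - cos ∂θ ≥ 1 - cos η`, a bond has
two endpoints) and `|collar D \ D| ≤ 6 |D|`.  Folklore.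
-/

noncomputable section

open scoped BigOperators Classical
open Finset MeasureTheory

namespace Literature.Probability.LatticeModels.BalabanStepOne

variable {L' M : ℕ} [NeZero L'] [NeZero M]

/-- The real Gibbs factor of the bond `b`: `exp (-K (1 - cos ∂_b θ))`, as a complex number. [folklore] -/
def bondWeight (K : ℝ) (θ : Site L' M → ℝ) (b : Site L' M × Fin 3) : ℂ :=
  ((Real.exp (-(K * (1 - Real.cos (θ (b.1 + dir L' M b.2) - θ b.1)))) : ℝ) : ℂ)

/-- The XY cluster activity with an EXPLICIT large-field set `Ω`: the product of the Gibbs factors of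
the bonds touching `P ∩ Ω`, provided `P` is connected, collar-closed (`P = collar (P ∩ Ω)`) and meets
`Ω`; zero otherwise. [folklore] -/
def xyActivityAux (K : ℝ) (P Ω : Finset (Site L' M)) (θ : Site L' M → ℝ) : ℂ :=
  if IsConn P ∧ P = collar (P ∩ Ω) ∧ (P ∩ Ω).Nonempty then
    ∏ b ∈ univ.filter (fun b : Site L' M × Fin 3 => Touch (P ∩ Ω) b), bondWeight K θ b
  else 0

/-- **The XY cluster activities**: `xyActivityAux` at the configuration's own large-field set. [folklore] -/
def xyActivity (K : ℝ) (P : Finset (Site L' M)) (θ : Site L' M → ℝ) : ℂ :=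
  xyActivityAux K P (lfSet K θ) θ

/-! #### Large-field membership is decided on the closed neighbourhood -/

/-- Membership in the large-field set, unfolded. [folklore] -/
theorem mem_lfSet_iff {K : ℝ} {θ : Site L' M → ℝ} {s : Site L' M} :
    s ∈ lfSet K θ ↔ ∃ i : Fin 3, Real.cos (θ (s + dir L' M i) - θ s) ≤ Real.cos (eta K) ∨
      Real.cos (θ s - θ (s - dir L' M i)) ≤ Real.cos (eta K) := by
  simp [lfSet]

/-- Whether a site is large-field depends only on the configuration at the site and its neighbours.
[folklore] -/
theorem mem_lfSet_congr {K : ℝ} {θ θ' : Site L' M → ℝ} {s : Site L' M} (h0 : θ s = θ' s)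
    (h1 : ∀ i, θ (s + dir L' M i) = θ' (s + dir L' M i)) (h2 : ∀ i, θ (s - dir L' M i) = θ' (s - dir L' M i)) :
    s ∈ lfSet K θ ↔ s ∈ lfSet K θ' := by
  simp only [mem_lfSet_iff, h0, h1, h2]

/-- Translation covariance of the large-field set. [folklore] -/
theorem mem_lfSet_transl {K : ℝ} {θ : Site L' M → ℝ} {t s : Site L' M} :
    s ∈ lfSet K (fun x => θ (x + t)) ↔ s + t ∈ lfSet K θ := by
  simp only [mem_lfSet_iff, add_right_comm _ t, add_sub_right_comm _ t]

/-- The large-field set of a translated configuration is the translated large-field set. [folklore] -/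
theorem lfSet_eq_image_transl (K : ℝ) (θ : Site L' M → ℝ) (t : Site L' M) :
    lfSet K θ = (lfSet K fun x => θ (x + t)).image (· + t) := by
  ext s
  simp only [mem_image]
  constructor
  · intro hs
    refine ⟨s - t, mem_lfSet_transl.2 (by rw [sub_add_cancel]; exact hs), sub_add_cancel s t⟩
  · rintro ⟨p, hp, rfl⟩
    exact mem_lfSet_transl.1 hp

omit [NeZero L'] [NeZero M] in
/-- A translated bond touches the translated set iff the bond touches the set. [folklore] -/
theorem touch_image_add_iff (D : Finset (Site L' M)) (t : Site L' M) (b : Site L' M × Fin 3) :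
    Touch (D.image (· + t)) (bondAdd t b) ↔ Touch D b := by
  have hinj : Function.Injective (fun x : Site L' M => x + t) := add_left_injective t
  simp only [Touch, bondAdd, Equiv.prodCongr_apply, Equiv.coe_addRight, Prod.map_fst, Prod.map_snd,
    Equiv.coe_refl, id_eq, add_right_comm _ t, hinj.mem_finset_image]

omit [NeZero L'] [NeZero M] in
/-- The Gibbs factor of a translated bond is the Gibbs factor of the bond in the translated
configuration. [folklore] -/
theorem bondWeight_bondAdd (K : ℝ) (θ : Site L' M → ℝ) (t : Site L' M) (b : Site L' M × Fin 3) :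
    bondWeight K θ (bondAdd t b) = bondWeight K (fun x => θ (x + t)) b := by
  simp only [bondWeight, bondAdd, Equiv.prodCongr_apply, Equiv.coe_addRight, Prod.map_fst, Prod.map_snd,
    Equiv.coe_refl, id_eq, add_right_comm _ t]

/-- Bond products over the bonds touching a translated set. [folklore] -/
theorem prod_touch_image_add (K : ℝ) (θ : Site L' M → ℝ) (t : Site L' M) (D : Finset (Site L' M)) :
    ∏ b ∈ univ.filter (fun b : Site L' M × Fin 3 => Touch (D.image (· + t)) b), bondWeight K θ b =
      ∏ b ∈ univ.filter (fun b : Site L' M × Fin 3 => Touch D b), bondWeight K (fun x => θ (x + t)) b := by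
  rw [prod_filter, prod_filter]
  symm
  refine Fintype.prod_equiv (bondAdd t) _ _ fun b => ?_
  simp only [touch_image_add_iff, bondWeight_bondAdd]

/-- Translation covariance of the auxiliary activities. [folklore] -/
theorem xyActivityAux_transl (K : ℝ) (P Ω : Finset (Site L' M)) (t : Site L' M) (θ : Site L' M → ℝ) :
    xyActivityAux K (P.image (· + t)) (Ω.image (· + t)) θ = xyActivityAux K P Ω fun x => θ (x + t) := by
  have hinj : Function.Injective (fun x : Site L' M => x + t) := add_left_injective t
  unfold xyActivityAux
  rw [← image_inter _ _ hinj, collar_image_add, isConn_image_add_iff, prod_touch_image_add]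
  simp only [(Finset.image_injective hinj).eq_iff, Finset.image_nonempty]

/-! #### `PolymerActivity` for the XY activities -/

/-- Off connected collar-closed polymers meeting `Ω` the auxiliary activity vanishes. [folklore] -/
theorem xyActivityAux_eq_zero {K : ℝ} {P Ω : Finset (Site L' M)} {θ : Site L' M → ℝ}
    (h : ¬ (IsConn P ∧ P = collar (P ∩ Ω) ∧ (P ∩ Ω).Nonempty)) : xyActivityAux K P Ω θ = 0 := by
  unfold xyActivityAux
  rw [if_neg h]

omit [NeZero L'] [NeZero M] in
/-- The bond Gibbs factors have modulus `exp (-K (1 - cos ∂θ))`. [folklore] -/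
theorem norm_bondWeight (K : ℝ) (θ : Site L' M → ℝ) (b : Site L' M × Fin 3) :
    ‖bondWeight K θ b‖ = Real.exp (-(K * (1 - Real.cos (θ (b.1 + dir L' M b.2) - θ b.1)))) := by
  unfold bondWeight
  rw [Complex.norm_real, Real.norm_eq_abs, Real.abs_exp]

/-- **Key counting estimate.** Every large-field site of `D` owns an incident bond with
`1 - cos ∂θ ≥ 1 - cos η`, and a bond has two endpoints; hence
`Σ_{b touching D} (1 - cos ∂_b θ) ≥ (1 - cos η) · |D| / 2` for `D ⊆ lfSet K θ`. [folklore] -/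
theorem sum_touch_ge {K : ℝ} {θ : Site L' M → ℝ} {D : Finset (Site L' M)} (hD : D ⊆ lfSet K θ) :
    (1 - Real.cos (eta K)) * (D.card : ℝ) / 2 ≤
      ∑ b ∈ univ.filter (fun b : Site L' M × Fin 3 => Touch D b),
        (1 - Real.cos (θ (b.1 + dir L' M b.2) - θ b.1)) := by
  classical
  -- the witnessing bond of a large-field site
  have hw : ∀ x ∈ D, ∃ b : Site L' M × Fin 3, (b.1 = x ∨ b.1 + dir L' M b.2 = x) ∧
      Real.cos (θ (b.1 + dir L' M b.2) - θ b.1) ≤ Real.cos (eta K) := by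
    intro x hx
    obtain ⟨i, h | h⟩ := mem_lfSet_iff.1 (hD hx)
    · exact ⟨(x, i), Or.inl rfl, h⟩
    · refine ⟨(x - dir L' M i, i), Or.inr (sub_add_cancel _ _), ?_⟩
      simp only [sub_add_cancel]
      exact h
  choose! wb hwb using hw
  set f : Site L' M × Fin 3 → ℝ := fun b => 1 - Real.cos (θ (b.1 + dir L' M b.2) - θ b.1) with hf
  have hf0 : ∀ b, 0 ≤ f b := fun b => by
    simp only [hf]; linarith [Real.cos_le_one (θ (b.1 + dir L' M b.2) - θ b.1)]
  -- the image of the witness map lies in the touching bonds, with fibres of size ≤ 2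
  have himg : D.image wb ⊆ univ.filter (fun b : Site L' M × Fin 3 => Touch D b) := by
    intro b hb
    obtain ⟨x, hx, rfl⟩ := mem_image.1 hb
    refine mem_filter.2 ⟨mem_univ _, ?_⟩
    rcases (hwb x hx).1 with h | h
    · exact Or.inl (by rw [h]; exact hx)
    · exact Or.inr (by rw [h]; exact hx)
  have hcard : D.card ≤ 2 * (D.image wb).card := by
    refine card_le_mul_card_image _ 2 fun b hb => ?_
    have hsub : D.filter (fun x => wb x = b) ⊆ {b.1, b.1 + dir L' M b.2} := by
      intro x hx
      obtain ⟨hxD, hxb⟩ := mem_filter.1 hx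
      simp only [mem_insert, mem_singleton]
      rcases (hwb x hxD).1 with h | h
      · exact Or.inl (by rw [← hxb, h])
      · exact Or.inr (by rw [← hxb, h])
    exact (card_le_card hsub).trans Finset.card_le_two
  have hval : ∀ b ∈ D.image wb, 1 - Real.cos (eta K) ≤ f b := by
    intro b hb
    obtain ⟨x, hx, rfl⟩ := mem_image.1 hb
    simp only [hf]
    linarith [(hwb x hx).2]
  calc (1 - Real.cos (eta K)) * (D.card : ℝ) / 2
      ≤ (1 - Real.cos (eta K)) * ((D.image wb).card : ℝ) := by
        have h1 : 0 ≤ 1 - Real.cos (eta K) := by linarith [Real.cos_le_one (eta K)]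
        have h2 : (D.card : ℝ) ≤ 2 * ((D.image wb).card : ℝ) := by exact_mod_cast hcard
        nlinarith
    _ = ∑ b ∈ D.image wb, (1 - Real.cos (eta K)) := by rw [sum_const, nsmul_eq_mul, mul_comm]
    _ ≤ ∑ b ∈ D.image wb, f b := sum_le_sum hval
    _ ≤ ∑ b ∈ univ.filter (fun b : Site L' M × Fin 3 => Touch D b), f b :=
        sum_le_sum_of_subset_of_nonneg himg fun b _ _ => hf0 b

/-- The threshold condition on `K` under which the XY cluster activities obey the format's large-field
bound with rates `cL` (per large-field site) and `κ` (per corridor site). [folklore] -/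
def XYThreshold (K cL κ : ℝ) : Prop :=
  pLF cL K + 6 * κ ≤ K * (1 - Real.cos (eta K)) / 2

/-- **Calibration (δ).** The XY cluster activities are polymer activities with rates `(cL, κ)` once
`pLF cL K + 6κ ≤ K (1 - cos η(K)) / 2` and `κ ≥ 0`. [folklore] -/
theorem xyActivity_polymerActivity {K cL κ : ℝ} (hK : 0 ≤ K) (hκ : 0 ≤ κ) (hth : XYThreshold K cL κ) :
    PolymerActivity K cL κ L' M (xyActivity (L' := L') (M := M) K) where
  local_ P θ θ' h := by
    have hLF : P ∩ lfSet K θ = P ∩ lfSet K θ' := by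
      ext s
      simp only [mem_inter]
      refine and_congr_right fun hs => mem_lfSet_congr (h s (subset_collar P hs)) (fun i => ?_) fun i => ?_
      · exact h _ (mem_collar_of_near hs (near_add_dir s i))
      · exact h _ (mem_collar_of_near hs (near_sub_dir s i))
    unfold xyActivity xyActivityAux
    rw [← hLF]
    split_ifs with hc
    · refine prod_congr rfl fun b hb => ?_
      have ht : Touch (P ∩ lfSet K θ) b := (mem_filter.1 hb).2
      have h1 : b.1 ∈ collar P := by
        rcases ht with ht | ht
        · exact subset_collar P (mem_inter.1 ht).1
        · exact mem_collar_of_near (mem_inter.1 ht).1 (near_add_dir b.1 b.2).symm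
      have h2 : b.1 + dir L' M b.2 ∈ collar P := by
        rcases ht with ht | ht
        · exact mem_collar_of_near (mem_inter.1 ht).1 (near_add_dir b.1 b.2)
        · exact subset_collar P (mem_inter.1 ht).1
      simp only [bondWeight, h _ h1, h _ h2]
    · rfl
  transl P t θ := by
    unfold xyActivity
    rw [lfSet_eq_image_transl K θ t, xyActivityAux_transl]
  conn P θ h := xyActivityAux_eq_zero fun hc => h hc.1
  meas P := by
    have hrepr : xyActivity (L' := L') (M := M) K P = fun θ =>
        ∑ Ω : Finset (Site L' M), if lfSet K θ = Ω then xyActivityAux K P Ω θ else 0 := by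
      funext θ
      rw [Finset.sum_ite_eq univ (lfSet K θ) (fun Ω => xyActivityAux K P Ω θ)]
      simp [xyActivity]
    rw [hrepr]
    refine Finset.measurable_sum _ fun Ω _ => Measurable.ite ?_ ?_ measurable_const
    · -- the fibre {θ | lfSet K θ = Ω} is measurable
      have hset : {θ : Site L' M → ℝ | lfSet K θ = Ω} =
          ⋂ s : Site L' M, {θ | s ∈ lfSet K θ ↔ s ∈ Ω} := by
        ext θ
        simp only [Set.mem_setOf_eq, Set.mem_iInter, Finset.ext_iff]
      rw [hset]
      refine MeasurableSet.iInter fun s => ?_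
      have hmeas : MeasurableSet {θ : Site L' M → ℝ | s ∈ lfSet K θ} := by
        have hset' : {θ : Site L' M → ℝ | s ∈ lfSet K θ} = ⋃ i : Fin 3,
            ({θ | Real.cos (θ (s + dir L' M i) - θ s) ≤ Real.cos (eta K)} ∪
              {θ | Real.cos (θ s - θ (s - dir L' M i)) ≤ Real.cos (eta K)}) := by
          ext θ
          simp only [Set.mem_setOf_eq, mem_lfSet_iff, Set.mem_iUnion, Set.mem_union]
        rw [hset']
        refine MeasurableSet.iUnion fun i => MeasurableSet.union ?_ ?_
        · exact measurableSet_le (by fun_prop) measurable_const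
        · exact measurableSet_le (by fun_prop) measurable_const
      by_cases hs : s ∈ Ω
      · have : {θ : Site L' M → ℝ | s ∈ lfSet K θ ↔ s ∈ Ω} = {θ | s ∈ lfSet K θ} := by
          ext θ; simp [hs]
        rw [this]; exact hmeas
      · have : {θ : Site L' M → ℝ | s ∈ lfSet K θ ↔ s ∈ Ω} = {θ | s ∈ lfSet K θ}ᶜ := by
          ext θ; simp [hs]
        rw [this]; exact hmeas.compl
    · unfold xyActivityAux
      split_ifs
      · refine Finset.measurable_prod _ fun b _ => ?_
        unfold bondWeight
        fun_prop
      · exact measurable_const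
  bound P θ := by
    unfold xyActivity
    by_cases hc : IsConn P ∧ P = collar (P ∩ lfSet K θ) ∧ (P ∩ lfSet K θ).Nonempty
    · have hPc := hc.2.1
      have hne := hc.2.2
      unfold xyActivityAux
      rw [if_pos hc, norm_prod]
      simp only [norm_bondWeight]
      rw [← Real.exp_sum, Real.exp_le_exp]
      have hsum := sum_touch_ge (K := K) (θ := θ) (D := P ∩ lfSet K θ) inter_subset_right
      have hsdiff : P \ lfSet K θ = collar (P ∩ lfSet K θ) \ (P ∩ lfSet K θ) := by
        rw [← hPc]
        exact (sdiff_inter_self_left P (lfSet K θ)).symm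
      have hcard1 : ((P \ lfSet K θ).card : ℝ) ≤ 6 * ((P ∩ lfSet K θ).card : ℝ) := by
        rw [hsdiff]; exact_mod_cast card_collar_sdiff_le (P ∩ lfSet K θ)
      have hDpos : (1 : ℝ) ≤ (P ∩ lfSet K θ).card := by exact_mod_cast hne.card_pos
      have hth' : pLF cL K + 6 * κ ≤ K * (1 - Real.cos (eta K)) / 2 := hth
      rw [sum_neg_distrib, neg_le_neg_iff, ← mul_sum]
      calc pLF cL K * ((P ∩ lfSet K θ).card : ℝ) + κ * ((P \ lfSet K θ).card : ℝ)
          ≤ pLF cL K * ((P ∩ lfSet K θ).card : ℝ) + κ * (6 * ((P ∩ lfSet K θ).card : ℝ)) := by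
            nlinarith
        _ = (pLF cL K + 6 * κ) * ((P ∩ lfSet K θ).card : ℝ) := by ring
        _ ≤ (K * (1 - Real.cos (eta K)) / 2) * ((P ∩ lfSet K θ).card : ℝ) := by nlinarith
        _ = K * ((1 - Real.cos (eta K)) * ((P ∩ lfSet K θ).card : ℝ) / 2) := by ring
        _ ≤ K * ∑ b ∈ univ.filter (fun b : Site L' M × Fin 3 => Touch (P ∩ lfSet K θ) b),
              (1 - Real.cos (θ (b.1 + dir L' M b.2) - θ b.1)) := mul_le_mul_of_nonneg_left hsum hK
    · rw [xyActivityAux_eq_zero hc, norm_zero]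
      exact (Real.exp_pos _).le

end Literature.Probability.LatticeModels.BalabanStepOne

end
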